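import Summits.BirchSwinnertonDyer.BirchSwinnertonDyer.Theorems.PrintCf2SplitBadTwoKummerUClassLevel
import HarnessLib

/-!
# Crux `PrintCf2.SplitBadTwoRankOneOfFacts` (stmt-BirchSwinnertonDyer-20368), skeleton v13.5, (REG₂) / M-LINE-PIN (R) FACT-FREE roads, R2 brick B4e′:
# THE CLASS-LEVEL (PRO-NULL)_U, `θ = 1`, LOSSY AT `v̄` — the `(v̄)` hypothesis weakened to «`p^M ∣ p^l · ord_{w′}(b)`», the level shifted by `l`

Cell `bsd-print-cf2`, EXTRA WIDTH seat `bsd-line-cf2-p1-w3` g14 (prover-bsd-line-cf2-p1-w3-g14-0); `--supports stmt-BirchSwinnertonDyer-20368`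
(helper, Theses-free). HONEST FRAMING: nothing here closes the crux or a registered stub; BSD is not proved by any of this; no summit
statement is proved by this seat. No definition, no named fact, no `sorry`. UNCONDITIONAL.

WHY. -w3 g13's `KummerU.exists_level_resH1Hom_eq_zero_of_local` (p703858, B4e) asks at `v̄` for «`p^M ∣ ord_{w′}(b)` at every `w′ ∣ v̄`»; B5-U
delivers that EXACTLY on the `v̄`-LINE (`v̄` totally ramified, FILE 2 p707091), but on layers where `v̄` is UNRAMIFIED and UNDECOMPOSED (the `v`-LINE
`K^{(v)}_m` of M-LINE-PIN's inner-regularity socket (R), LEAD g14 07:39:56Z) the norm trick only gives «`p^M ∣ [F:K] · ord_{w′}(b)`» (FILE 3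
`NormAtVbar.dvd_mul_log_valuation_of_dualShapiro_mem_of_unramified`, `[F:K] = p^m`). This file absorbs the loss by a LEVEL SHIFT:
**`exists_level_resH1Hom_eq_zero_of_local_lossy (l : ℕ)`** = p703858 VERBATIM except that the `(v̄)` hypothesis reads
`∀ w′ : vbar.Extension (𝓞 F), (p^M : ℤ) ∣ (p^l : ℤ) * log (w′.1.valuation F b)` (and the level produced is `M = M₀ + l`, `M₀` the level of
B4d′ p702625 for `k`): the `p^M`-th root data at `v` / off `{v, v̄}` are raised to the `p^l`-th power (`p^{M₀}`-th roots of `b`), and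
`p^{M₀ + l} ∣ p^l · ord` gives `p^{M₀} ∣ ord`. `l = 0` is p703858. presearch: none needed (level bookkeeping on tree theorems).
beyond-print theorem: no.

References: [deShalit1987] III.2.3; [SerreLocalFields1979] X §3 b); [NeukirchSchmidtWingberg2008] I §5.
-/

noncomputable section

set_option linter.dupNamespace false
set_option autoImplicit false

open scoped Classical
open Field
open Literature.NumberTheory.EllipticCurves Literature.NumberTheory.EllipticCurves.GreenbergSelmer
open Literature.NumberTheory.EllipticCurves.GreenbergVatsal2000
open Literature.NumberTheory.GaloisRepresentations Literature.NumberTheory.GaloisRepresentations.LocalWeilDatum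

namespace Summit.BirchSwinnertonDyer.BirchSwinnertonDyer.Theorems.PrintCf2.KummerU

section AssemblyLossy

open NumberField IsDedekindDomain
open Summit.BirchSwinnertonDyer.BirchSwinnertonDyer.Theorems.PrintCf2.UpperBaseLift (mem_unramifiedKer_iff_resOfLe_inf_inertia_eq_zero)

variable {K : Type} [Field K] [NumberField K] {p : ℕ} [Fact p.Prime]

/-- **CLASS-LEVEL (PRO-NULL)_U, `θ = 1`, LOSSY AT `v̄`.** As `exists_level_resH1Hom_eq_zero_of_local` (p703858) with the `(v̄)` hypothesis
weakened to «`p^M ∣ p^l · ord_{w′}(b)` at every `w′ ∣ v̄`» for a fixed `l` (the level `M` depends on `l`): `K` imaginary quadratic, `p = v·v̄`,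
`F ⊆ K̄` finite abelian over `K`, `U = Gal(K̄/F)`; for every `k` there is `M ≥ k` such that every class `y ∈ H¹(U, X)` (coefficient models
`ι : X ↪ K̄ˣ`, `p^M • X = 0`, `ι₀ : X₀ ↪ K̄ˣ ⊇ μ_{p^k}`, level map `t`) which is locally trivial above `v`, unramified above `w ∉ {v, v̄}`, and whose
Kummer element `b = β^{p^M}` has `p^M ∣ p^l · ord_{w′}(b)` above `v̄`, has `resH1Hom id t y = 0`. [cite: deShalit1987, III.2.3 (Theorem (Baker–Brumer))]
[cite: SerreLocalFields1979, X §3 b)] [cite: NeukirchSchmidtWingberg2008, I §5] -/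
theorem exists_level_resH1Hom_eq_zero_of_local_lossy (l : ℕ) (hK : IsImaginaryQuadratic K) {v vbar : HeightOneSpectrum (𝓞 K)}
    (hv : ((p : ℕ) : 𝓞 K) ∈ v.asIdeal) (hvbar : ((p : ℕ) : 𝓞 K) ∈ vbar.asIdeal) (hne : vbar ≠ v)
    (F : IntermediateField K (AlgebraicClosure K)) [FiniteDimensional K F] [IsAbelianGalois K F] [NumberField F]
    [(galFixing K F).Normal] (k : ℕ) :
    ∃ M : ℕ, k ≤ M ∧
      ∀ {X : Type} [AddCommGroup X] [DistribMulAction (absoluteGaloisGroup K) X] [TopologicalSpace X] [DiscreteTopology X]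
        {X₀ : Type} [AddCommGroup X₀] [DistribMulAction (absoluteGaloisGroup K) X₀] [TopologicalSpace X₀] [DiscreteTopology X₀]
        (ι : X →+ Additive (AlgebraicClosure K)ˣ) (_ : Function.Injective ι)
        (_ : ∀ (g : absoluteGaloisGroup K) (x : X), Additive.toMul (ι (g • x)) = g • Additive.toMul (ι x))
        (_ : ∀ x : X, p ^ M • x = 0)
        (ι₀ : X₀ →+ Additive (AlgebraicClosure K)ˣ) (_ : Function.Injective ι₀)
        (_ : ∀ (g : absoluteGaloisGroup K) (x : X₀), Additive.toMul (ι₀ (g • x)) = g • Additive.toMul (ι₀ x))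
        (_ : ∀ m : (AlgebraicClosure K)ˣ, m ^ p ^ k = 1 → ∃ a₀ : X₀, Additive.toMul (ι₀ a₀) = m)
        (t : X →+ X₀) (ht : ∀ (g : absoluteGaloisGroup K) (x : X), t (g • x) = g • t x)
        (_ : ∀ x : X, Additive.toMul (ι₀ (t x)) = Additive.toMul (ι x) ^ p ^ (M - k))
        (φ : contOneCocycles (discreteTopRep (galFixing K F) X)),
        (∀ σ : absoluteGaloisGroup K, conjH1 (galFixing K F) X σ (oneCocycleClass _ φ) ∈ awayKer (galFixing K F) X v) →
        (∀ w : HeightOneSpectrum (𝓞 K), w ≠ v → w ≠ vbar →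
          ∀ σ : absoluteGaloisGroup K, conjH1 (galFixing K F) X σ (oneCocycleClass _ φ) ∈ unramifiedKer (galFixing K F) X w) →
        (∀ β : (AlgebraicClosure K)ˣ, (∀ u : galFixing K F, Additive.toMul (ι (φ.1 u)) = (u : absoluteGaloisGroup K) • β / β) →
          ∀ b : F, ((b : F) : AlgebraicClosure K) = ((β ^ p ^ M : (AlgebraicClosure K)ˣ) : AlgebraicClosure K) →
          ∀ w' : vbar.Extension (𝓞 F), ((p ^ M : ℕ) : ℤ) ∣ ((p ^ l : ℕ) : ℤ) * WithZero.log (w'.1.valuation F b)) →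
        resH1Hom (ContinuousMonoidHom.id (galFixing K F)) t (fun g x ↦ ht g x) (oneCocycleClass _ φ) = 0 := by
  have hp : p.Prime := Fact.out
  obtain ⟨M₀, hkM₀, hM⟩ := exists_level_forall_exists_pow_eq_of_galois' (p := p) hK hv hvbar hne F k
  -- the level is shifted by `l`
  refine ⟨M₀ + l, hkM₀.trans (Nat.le_add_right M₀ l), ?_⟩
  set M := M₀ + l with hMdef
  have hkM : k ≤ M := hkM₀.trans (Nat.le_add_right M₀ l)
  have hpowM : ∀ x : AlgebraicClosure K, x ^ p ^ M = (x ^ p ^ l) ^ p ^ M₀ := fun x ↦ by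
    rw [← pow_mul, ← pow_add, add_comm, hMdef]
  intro X _ _ _ _ X₀ _ _ _ _ ι hιinj hι hX ι₀ hι₀inj hι₀ hι₀surj t ht htι φ hloc hunr hbar
  -- the trivial twist
  have hι1 : ∀ (g : absoluteGaloisGroup K) (x : X),
      Additive.toMul (ι (g • x)) = (g • Additive.toMul (ι x)) ^ (((1 : absoluteGaloisGroup K →* ℤˣ) g : ℤˣ) : ℤ) := fun g x ↦ by
    rw [hι, MonoidHom.one_apply, Units.val_one, zpow_one]
  have hι₀1 : ∀ (g : absoluteGaloisGroup K) (x : X₀),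
      Additive.toMul (ι₀ (g • x)) = (g • Additive.toMul (ι₀ x)) ^ (((1 : absoluteGaloisGroup K →* ℤˣ) g : ℤˣ) : ℤ) := fun g x ↦ by
    rw [hι₀, MonoidHom.one_apply, Units.val_one, zpow_one]
  -- §1: the attached cocycle `c : Γ_K → K̄ˣ`
  obtain ⟨c, hc, -, -⟩ := exists_twistedCocycle_of_oneCocycle (galFixing K F) (1 : absoluteGaloisGroup K →* ℤˣ) ι hι1 φ hX
  -- Kummer over `U = Gal(K̄/F)`: `c = ∂β` on `U`, `β^{p^M} = b ∈ F`
  have hcoc : ∀ g h : galFixing K F, (fun g : galFixing K F ↦ Additive.toMul (ι (φ.1 g))) (g * h) =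
      (fun g : galFixing K F ↦ Additive.toMul (ι (φ.1 g))) g *
        (g : absoluteGaloisGroup K) • (fun g : galFixing K F ↦ Additive.toMul (ι (φ.1 g))) h := by
    intro g h
    simp only
    have h2 : φ.1 (g * h) = φ.1 g + ((g : absoluteGaloisGroup K) • φ.1 h : X) := φ.2 g h
    rw [h2, map_add, toMul_add, hι]
  have hopen : IsOpen {g : galFixing K F | (fun g : galFixing K F ↦ Additive.toMul (ι (φ.1 g))) g = 1} := by
    have h0 : {g : galFixing K F | (fun g : galFixing K F ↦ Additive.toMul (ι (φ.1 g))) g = 1} = φ.1 ⁻¹' {0} := by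
      ext g
      simp only [Set.mem_setOf_eq, Set.mem_preimage, Set.mem_singleton_iff]
      constructor
      · intro h
        apply hιinj
        rw [map_zero]
        exact Additive.toMul.injective (by rw [h, toMul_zero])
      · intro h
        rw [h, map_zero, toMul_zero]
    rw [h0]
    exact (isOpen_discrete _).preimage φ.1.continuous
  have hn : ∀ g : galFixing K F, (fun g : galFixing K F ↦ Additive.toMul (ι (φ.1 g))) g ^ p ^ M = 1 := fun g ↦ by
    simp only
    rw [← toMul_nsmul, ← map_nsmul, hX, map_zero, toMul_zero]
  obtain ⟨β, b, hb, hcβ⟩ := galFixing.exists_kummer_of_cocycle_charZero F (p ^ M) _ hcoc hopen hn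
  have hres : ∀ u ∈ galFixing K F, c u = u • β / β := fun u hu ↦ by rw [hc u hu]; exact hcβ ⟨u, hu⟩
  have hβM : ((β : AlgebraicClosure K)) ^ p ^ M = ((b : F) : AlgebraicClosure K) := hb.symm
  have hb0 : b ≠ 0 := by
    intro h0
    rw [h0] at hb
    exact (β ^ p ^ M).ne_zero (by rw [Units.val_pow_eq_pow_val]; exact hb.symm.trans (map_zero _))
  -- §2: root forms at `v` and off `v, v̄`
  have hrootv : ∀ σ : absoluteGaloisGroup K, ∃ β' : AlgebraicClosure K, β' ^ p ^ M₀ = ((b : F) : AlgebraicClosure K) ∧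
      ∀ τ : absoluteGaloisGroup K, τ ∈ galFixing K F → σ * τ * σ⁻¹ ∈ decomp v → τ • β' = β' := by
    intro σ
    obtain ⟨β', hβ', hfix⟩ := exists_root_fixed_of_resOfLe_conjH1_eq_zero hι1 φ hX hc le_rfl (fun _ _ ↦ rfl) hres
      (decomp v) σ (hloc σ)
    refine ⟨(β' : AlgebraicClosure K) ^ p ^ l, ?_, fun τ hτ hτD ↦ ?_⟩
    · rw [← hpowM, ← hβM, ← Units.val_pow_eq_pow_val, hβ', Units.val_pow_eq_pow_val]
    · rw [smul_pow', ← Units.coe_smul, hfix τ hτ hτD]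
  have hrootw : ∀ w : HeightOneSpectrum (𝓞 K), w ≠ v → w ≠ vbar → ∀ σ : absoluteGaloisGroup K,
      ∃ β' : AlgebraicClosure K, β' ^ p ^ M₀ = ((b : F) : AlgebraicClosure K) ∧
        ∀ τ : absoluteGaloisGroup K, τ ∈ galFixing K F → σ * τ * σ⁻¹ ∈ GreenbergSelmer.inertia w → τ • β' = β' := by
    intro w hwv hwvbar σ
    have h0 := (mem_unramifiedKer_iff_resOfLe_inf_inertia_eq_zero (H := galFixing K F) (w := w) _).1 (hunr w hwv hwvbar σ)
    obtain ⟨β', hβ', hfix⟩ := exists_root_fixed_of_resOfLe_conjH1_eq_zero hι1 φ hX hc le_rfl (fun _ _ ↦ rfl) hres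
      (GreenbergSelmer.inertia w) σ h0
    refine ⟨(β' : AlgebraicClosure K) ^ p ^ l, ?_, fun τ hτ hτI ↦ ?_⟩
    · rw [← hpowM, ← hβM, ← Units.val_pow_eq_pow_val, hβ', Units.val_pow_eq_pow_val]
    · rw [smul_pow', ← Units.coe_smul, hfix τ hτ hτI]
  have hpc : ((p ^ l : ℕ) : ℤ) ≠ 0 := by exact_mod_cast pow_ne_zero l hp.ne_zero
  have hbar' : ∀ w' : vbar.Extension (𝓞 F), ((p ^ M₀ : ℕ) : ℤ) ∣ WithZero.log (w'.1.valuation F b) := fun w' ↦ by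
    have h := hbar β hcβ b (by rw [Units.val_pow_eq_pow_val]; exact hb) w'
    rw [hMdef, pow_add, Nat.cast_mul, mul_comm ((p ^ M₀ : ℕ) : ℤ)] at h
    exact (mul_dvd_mul_iff_left hpc).mp h
  -- B4d′: `b` is a `p^k`-th power in `F`
  obtain ⟨y₀, hy₀⟩ := hM b hb0 hrootv hrootw hbar'
  have hy₀0 : y₀ ≠ 0 := by
    intro h0
    rw [h0, zero_pow (pow_ne_zero _ hp.ne_zero)] at hy₀
    exact hb0 hy₀.symm
  -- read back on the cocycle: `(gβ/β)^{p^{M−k}} = gζ/ζ`, `ζ^{p^k} = 1`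
  have hβy : (β : AlgebraicClosure K) ^ p ^ M = ((y₀ : F) : AlgebraicClosure K) ^ p ^ k := by
    rw [hβM, ← hy₀]
    rfl
  have hy₀' : ((y₀ : F) : AlgebraicClosure K) ≠ 0 := by
    rw [Ne, ← map_zero (algebraMap F (AlgebraicClosure K))]
    exact fun h ↦ hy₀0 ((algebraMap F (AlgebraicClosure K)).injective h)
  obtain ⟨ζ, hζ, hζ0, hζcob⟩ := kummerCocycle_pow_eq_of_pow_eq (G := absoluteGaloisGroup K) hp.pos hkM hy₀' hβy
  -- §3: the pushed class vanishes
  refine resH1Hom_id_eq_zero_of_twistedCoboundary ι₀ hι₀inj hι₀1 t ht htι φ hc (hι₀surj (Units.mk0 ζ hζ0) (Units.ext ?_)) ?_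
  · rw [Units.val_pow_eq_pow_val, Units.val_mk0, hζ, Units.val_one]
  · intro g hg
    have hgy : g • ((y₀ : F) : AlgebraicClosure K) = (y₀ : F) := (mem_galFixing_iff K).1 hg _ y₀.2
    apply Units.ext
    rw [hres g hg, MonoidHom.one_apply, Units.val_one, zpow_one, Units.val_pow_eq_pow_val, Units.val_div_eq_div_val,
      Units.coe_smul, Units.val_div_eq_div_val, Units.coe_smul, Units.val_mk0]
    exact hζcob g hgy

end AssemblyLossy

end Summit.BirchSwinnertonDyer.BirchSwinnertonDyer.Theorems.PrintCf2.KummerU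

end
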